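import Summits.CriticalPhenomena.PercolationContinuityZ3.Theorems.PercNearOneGluingAdditiveGluingFingerTwoContactsB
import Summits.CriticalPhenomena.PercolationContinuityZ3.Theorems.PercNearOneGluingAdditiveGluingFingerFourRelays
import HarnessLib

/-! # Crux `PercNearOneGluing.AdditiveGluing` (stmt-CriticalPhenomena-4576) — the finger multi-edge Lemma 3 for at most FOUR relays,
# fingers may touch the target (seat (b) V⁺-form, depth prover `png-dp-vplus`)

Support file (`--supports stmt-CriticalPhenomena-4576`); no definitions, no named facts.  Removes the hypothesis "no finger adjacent to `b`"
from `…AdditiveGluingFingerFourRelays.lean` (`fingerML3_of_card_le_four_noB`), using the certificate `fingerML3_twoContactsB_core` for two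
base-weak contact relays with fingers touching `b` (`…AdditiveGluingFingerTwoContactsB.lean`).

* `real_fingerR_eq_threeRelayR`: with relays `A ⊆ {b, d, w₁, w₂}` and the pairs `N–d` of weight `0`, "some pair `N–A` open" may be replaced by
  "some pair of `{v w₁} ∪ {v w₂} ∪ {v b}` open" inside any probability.
* `fingerML3_fourRelays_dUntouchedB`: FML3 for `A ⊆ {b, d, w₁, w₂}`, `d` untouched, fingers pairwise non-adjacent (cases on the base
  comparisons: `fingerML3_of_qMinimal` / `fingerML3_of_baseMin_erase` / `fingerML3_twoContactsB_core`).
* `fingerML3_of_card_le_four`: the registered stub `stub_fingerML3_vp` for `A.card ≤ 4` and fingers pairwise non-adjacent — strip the pairs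
  `N–d` (`fingerML3_of_le_blockVertex` / `fingerML3_hyp_dPairsKilled` + `fingerML3_of_dPairsKilled`), then the previous theorem.
[cite: KozmaNitzan2024, Lemma 3 (pp. 6–7), Lemma 5 (p. 13), §3.2 pp. 12–14, §4 p. 20, Question 9 (p. 36)]
-/

namespace Summit.CriticalPhenomena.PercolationContinuityZ3.Theorems

open MeasureTheory Set
open Literature.Probability.LatticeModels (prodBernoulli)
open Literature.Probability.Percolation (BondConfig openConn openGraph)

noncomputable section
open Classical

section FingerFourRelaysB

open Literature.Probability.LatticeModels Literature.Probability.Percolation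

variable {n : ℕ}

/-- With relays `A ⊆ {b, d, w₁, w₂}` (`w₁, w₂, b ∈ A`) and the pairs `N–d` of weight `0`, the event "some pair `N–A` open" may be replaced by
"some pair of `{v w₁} ∪ {v w₂} ∪ {v b}` open" inside any probability. [folklore] -/
theorem real_fingerR_eq_threeRelayR (g : Sym2 (Fin n) → unitInterval) (A N : Finset (Fin n)) (w₁ w₂ d b : Fin n)
    (hAform : ∀ a ∈ A, a = b ∨ a = d ∨ a = w₁ ∨ a = w₂) (hw₁A : w₁ ∈ A) (hw₂A : w₂ ∈ A) (hb : b ∈ A)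
    (h0d : ∀ v ∈ N, g s(v, d) = 0) (E : Set (BondConfig (Fin n))) :
    (prodBernoulli g).real ({ω : Set (Sym2 (Fin n)) | ∃ v ∈ N, ∃ a ∈ A, s(v, a) ∈ ω} ∩ E) =
      (prodBernoulli g).real
        ({ω : Set (Sym2 (Fin n)) | ∃ e ∈ N.image (fun v => s(v, w₁)) ∪ N.image (fun v => s(v, w₂)) ∪ N.image (fun v => s(v, b)),
          e ∈ ω} ∩ E) := by
  have hae : ∀ᵐ ω ∂(prodBernoulli g), ∀ v ∈ N, s(v, d) ∉ ω := by
    refine (Filter.eventually_all_finset N).2 fun v hv => ?_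
    exact prodBernoulli_ae_notMem g (h0d v hv)
  refine measureReal_congr ?_
  filter_upwards [hae] with ω hω
  refine propext ⟨?_, ?_⟩
  · rintro ⟨⟨v, hv, a, ha, hva⟩, hE⟩
    refine ⟨?_, hE⟩
    rcases hAform a ha with rfl | rfl | rfl | rfl
    · exact ⟨s(v, a), Finset.mem_union.2 (Or.inr (Finset.mem_image.2 ⟨v, hv, rfl⟩)), hva⟩
    · exact ((hω v hv) hva).elim
    · exact ⟨s(v, a), Finset.mem_union.2 (Or.inl (Finset.mem_union.2 (Or.inl (Finset.mem_image.2 ⟨v, hv, rfl⟩)))), hva⟩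
    · exact ⟨s(v, a), Finset.mem_union.2 (Or.inl (Finset.mem_union.2 (Or.inr (Finset.mem_image.2 ⟨v, hv, rfl⟩)))), hva⟩
  · rintro ⟨⟨e, he, heω⟩, hE⟩
    refine ⟨?_, hE⟩
    rcases Finset.mem_union.1 he with he' | h
    · rcases Finset.mem_union.1 he' with h | h
      · obtain ⟨v, hv, rfl⟩ := Finset.mem_image.1 h
        exact ⟨v, hv, w₁, hw₁A, heω⟩
      · obtain ⟨v, hv, rfl⟩ := Finset.mem_image.1 h
        exact ⟨v, hv, w₂, hw₂A, heω⟩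
    · obtain ⟨v, hv, rfl⟩ := Finset.mem_image.1 h
      exact ⟨v, hv, b, hb, heω⟩

/-- **FML3 for relays `{b, d, w₁, w₂}`, `d` untouched, fingers may touch `b`.**  Stub setting with `A ⊆ {b, d, w₁, w₂}` (`w₁ ≠ w₂`, both
`≠ b`), the pairs `N–d` and the internal pairs of `N` of weight `0`: `μ_{K/N}(R ∩ {d↔b}) ≤ μ_{K/N}(R ∩ ⋃_{v∈N}{v↔b})`.  Cases on the base comparisons
`μ_q(d↔b) ≤ μ_q(w_i↔b)` (`q` = pairs at `N` killed): both ⇒ `fingerML3_of_qMinimal`; one ⇒ `fingerML3_of_baseMin_erase`; none ⇒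
`fingerML3_twoContactsB_core`. [cite: KozmaNitzan2024, Lemma 3 (pp. 6–7), Lemma 5 (p. 13), §4 p. 20, Question 9 (p. 36)] -/
theorem fingerML3_fourRelays_dUntouchedB (K : Sym2 (Fin n) → unitInterval) (A N : Finset (Fin n)) (w₁ w₂ d b : Fin n)
    (hNA : Disjoint N A) (hd : d ∈ A) (hb : b ∈ A) (hw₁A : w₁ ∈ A) (hw₂A : w₂ ∈ A)
    (hAform : ∀ a ∈ A, a = b ∨ a = d ∨ a = w₁ ∨ a = w₂) (h12 : w₁ ≠ w₂) (h1b : w₁ ≠ b) (h2b : w₂ ≠ b)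
    (hfree : ∀ v ∈ N, ∀ y : Fin n, y ∉ A → y ∉ N → (K s(v, y) : ℝ) = 0)
    (hle : ∀ a ∈ A, (prodBernoulli K).real (openConn d b) ≤ (prodBernoulli K).real (openConn a b))
    (h0d : ∀ v ∈ N, K s(v, d) = 0)
    (hint : ∀ v ∈ N, ∀ v' ∈ N, v ≠ v' → K s(v, v') = 0) :
    (prodBernoulli (fun e' : Sym2 (Fin n) => if (∀ y ∈ e', y ∈ N) ∧ ¬ e'.IsDiag then 1 else K e')).real
        ({ω : Set (Sym2 (Fin n)) | ∃ v ∈ N, ∃ a ∈ A, s(v, a) ∈ ω} ∩ openConn d b) ≤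
      (prodBernoulli (fun e' : Sym2 (Fin n) => if (∀ y ∈ e', y ∈ N) ∧ ¬ e'.IsDiag then 1 else K e')).real
        ({ω : Set (Sym2 (Fin n)) | ∃ v ∈ N, ∃ a ∈ A, s(v, a) ∈ ω} ∩ ⋃ v ∈ N, openConn v b) := by
  have hdN : d ∉ N := Finset.disjoint_left.1 hNA.symm hd
  have hbN : b ∉ N := Finset.disjoint_left.1 hNA.symm hb
  have hw₁N : w₁ ∉ N := Finset.disjoint_left.1 hNA.symm hw₁A
  have hw₂N : w₂ ∉ N := Finset.disjoint_left.1 hNA.symm hw₂A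
  set q : Sym2 (Fin n) → unitInterval := fun e' => if (∃ y ∈ e', y ∈ N) then (0 : unitInterval) else K e' with hq
  have hqb : (prodBernoulli q).real (openConn d b) ≤ (prodBernoulli q).real (openConn b b) := by
    rw [openConn_self_real_eq_one q b]
    exact measureReal_le_one
  by_cases hq1 : (prodBernoulli q).real (openConn d b) ≤ (prodBernoulli q).real (openConn w₁ b)
  · by_cases hq2 : (prodBernoulli q).real (openConn d b) ≤ (prodBernoulli q).real (openConn w₂ b)
    · -- `d` is base-minimal
      refine fingerML3_of_qMinimal K A N d b hNA hd hfree fun a ha => ?_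
      rcases hAform a ha with rfl | rfl | rfl | rfl
      · exact hqb
      · exact le_rfl
      · exact hq1
      · exact hq2
    · -- only `w₂` is base-weak
      refine fingerML3_of_baseMin_erase K A N d w₂ b hNA hd hfree hle fun a ha hne => ?_
      rcases hAform a ha with rfl | rfl | rfl | rfl
      · exact hqb
      · exact le_rfl
      · exact hq1
      · exact (hne rfl).elim
  · by_cases hq2 : (prodBernoulli q).real (openConn d b) ≤ (prodBernoulli q).real (openConn w₂ b)
    · -- only `w₁` is base-weak
      refine fingerML3_of_baseMin_erase K A N d w₁ b hNA hd hfree hle fun a ha hne => ?_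
      rcases hAform a ha with rfl | rfl | rfl | rfl
      · exact hqb
      · exact le_rfl
      · exact (hne rfl).elim
      · exact hq2
    · -- both base-weak: the two-contact core with fingers touching `b`
      have hcont : ∀ v ∈ N, ∀ z : Fin n, z ∉ N → z ≠ w₁ → z ≠ w₂ → z ≠ b → K s(v, z) = 0 := by
        intro v hv z hzN hz1 hz2 hzb
        by_cases hzA : z ∈ A
        · rcases hAform z hzA with rfl | rfl | rfl | rfl
          · exact (hzb rfl).elim
          · exact h0d v hv
          · exact (hz1 rfl).elim
          · exact (hz2 rfl).elim
        · exact Set.Icc.coe_eq_zero.1 (hfree v hv z hzA hzN)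
      have hweak₁ := le_of_lt (lt_of_not_ge hq1)
      have hweak₂ := le_of_lt (lt_of_not_ge hq2)
      have hcore := fingerML3_twoContactsB_core K N w₁ w₂ d b hw₁N hw₂N hdN hbN h12 h1b h2b hint hcont (hle w₁ hw₁A) (hle w₂ hw₂A)
        hweak₁ hweak₂
      have hg0 : ∀ x : Fin n, x ∉ N → (∀ v ∈ N, K s(v, x) = 0) → ∀ v ∈ N,
          (fun e' : Sym2 (Fin n) => if (∀ y ∈ e', y ∈ N) ∧ ¬ e'.IsDiag then 1 else K e') s(v, x) = 0 := by
        intro x hxN h0 v hv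
        have hnot : ¬ ((∀ y ∈ s(v, x), y ∈ N) ∧ ¬ (s(v, x)).IsDiag) := fun h => hxN (h.1 x (Sym2.mem_mk_right v x))
        simp only [hnot, if_false]
        exact h0 v hv
      rw [real_fingerR_eq_threeRelayR _ A N w₁ w₂ d b hAform hw₁A hw₂A hb (hg0 d hdN h0d),
        real_fingerR_eq_threeRelayR _ A N w₁ w₂ d b hAform hw₁A hw₂A hb (hg0 d hdN h0d)]
      exact hcore

/-- **`stub_fingerML3_vp` for at most four relays** (fingers pairwise non-adjacent, possibly touching the target).  The registered stub's hypotheses (`b, d ∈ A`, finger block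
`N` disjoint from `A`, fingers free off `A`, `μ_K(d↔b) ≤ μ_K(a↔b)` on `A`) together with `A.card ≤ 4` and fingers pairwise
non-adjacent give the finger multi-edge Lemma 3: `μ_{K/N}(R ∩ {d↔b}) ≤ μ_{K/N}(R ∩ ⋃_{v∈N}{v↔b})`.
[cite: KozmaNitzan2024, Lemma 3 (pp. 6–7), Lemma 5 (p. 13), §3.2 pp. 12–14, §4 p. 20, Question 9 (p. 36)] -/
theorem fingerML3_of_card_le_four (K : Sym2 (Fin n) → unitInterval) (A N : Finset (Fin n)) (d b : Fin n)
    (hb : b ∈ A) (hNA : Disjoint N A) (hd : d ∈ A) (hA4 : A.card ≤ 4)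
    (hfree : ∀ v ∈ N, ∀ y : Fin n, y ∉ A → y ∉ N → (K s(v, y) : ℝ) = 0)
    (hle : ∀ a ∈ A, (prodBernoulli K).real (openConn d b) ≤ (prodBernoulli K).real (openConn a b))
    (hint : ∀ v ∈ N, ∀ v' ∈ N, v ≠ v' → (K s(v, v') : ℝ) = 0) :
    (prodBernoulli (fun e' : Sym2 (Fin n) => if (∀ y ∈ e', y ∈ N) ∧ ¬ e'.IsDiag then 1 else K e')).real
        ({ω : Set (Sym2 (Fin n)) | ∃ v ∈ N, ∃ a ∈ A, s(v, a) ∈ ω} ∩ openConn d b) ≤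
      (prodBernoulli (fun e' : Sym2 (Fin n) => if (∀ y ∈ e', y ∈ N) ∧ ¬ e'.IsDiag then 1 else K e')).real
        ({ω : Set (Sym2 (Fin n)) | ∃ v ∈ N, ∃ a ∈ A, s(v, a) ∈ ω} ∩ ⋃ v ∈ N, openConn v b) := by
  by_cases hdb : d = b
  · subst hdb
    exact fingerML3_of_eq_target K A N d hNA hle
  by_cases hA3 : A.card ≤ 3
  · exact fingerML3_of_card_le_three K A N d b hb hNA hd hA3 hfree hle
  -- four relays: `A = {b, d, w₁, w₂}`
  have hcard : ((A.erase b).erase d).card = 2 := by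
    have h1 : (A.erase b).card = A.card - 1 := Finset.card_erase_of_mem hb
    have h2 : ((A.erase b).erase d).card = (A.erase b).card - 1 :=
      Finset.card_erase_of_mem (Finset.mem_erase.2 ⟨hdb, hd⟩)
    omega
  obtain ⟨w₁, w₂, h12, hS⟩ := Finset.card_eq_two.1 hcard
  have hw₁S : w₁ ∈ (A.erase b).erase d := by
    rw [hS]
    simp
  have hw₂S : w₂ ∈ (A.erase b).erase d := by
    rw [hS]
    simp
  have hw₁A : w₁ ∈ A := Finset.mem_of_mem_erase (Finset.mem_of_mem_erase hw₁S)
  have hw₂A : w₂ ∈ A := Finset.mem_of_mem_erase (Finset.mem_of_mem_erase hw₂S)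
  have h1b : w₁ ≠ b := (Finset.mem_erase.1 (Finset.mem_erase.1 hw₁S).2).1
  have h2b : w₂ ≠ b := (Finset.mem_erase.1 (Finset.mem_erase.1 hw₂S).2).1
  have hAform : ∀ a ∈ A, a = b ∨ a = d ∨ a = w₁ ∨ a = w₂ := by
    intro a ha
    by_cases hab : a = b
    · exact Or.inl hab
    by_cases had : a = d
    · exact Or.inr (Or.inl had)
    have haS : a ∈ (A.erase b).erase d := Finset.mem_erase.2 ⟨had, Finset.mem_erase.2 ⟨hab, ha⟩⟩
    rw [hS] at haS
    rcases Finset.mem_insert.1 haS with h | h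
    · exact Or.inr (Or.inr (Or.inl h))
    · exact Or.inr (Or.inr (Or.inr (Finset.mem_singleton.1 h)))
  -- strip the pairs `N–d`
  have hdN : d ∉ N := Finset.disjoint_left.1 hNA.symm hd
  by_cases hone : ∃ v ∈ N, K s(v, d) = 1
  · -- a sure pair `v–d`: `d` is below the block vertex `v`
    obtain ⟨v, hv, h1⟩ := hone
    have hvd : v ≠ d := fun h => hdN (h ▸ hv)
    have hae := prodBernoulli_ae_mem_of_eq_one K h1
    have hle_v : (prodBernoulli K).real (openConn d b) ≤ (prodBernoulli K).real (openConn v b) := by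
      refine ENNReal.toReal_mono (measure_ne_top _ _) (measure_mono_ae ?_)
      filter_upwards [hae] with ω hω hdb'
      exact ((openGraph_adj ω v d).2 ⟨hω, hvd⟩).reachable.trans hdb'
    exact fingerML3_of_le_blockVertex K A N d b v hb hNA hv hfree hle_v
  · push Not at hone
    have hlt : ∀ v ∈ N, (K s(v, d) : ℝ) < 1 := by
      intro v hv
      have hne : K s(v, d) ≠ 1 := hone v hv
      have hle1 : (K s(v, d) : ℝ) ≤ 1 := (K s(v, d)).2.2
      rcases hle1.lt_or_eq with h | h
      · exact h
      · exact (hne (Subtype.ext h)).elim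
    set K' : Sym2 (Fin n) → unitInterval := fun e' => if (∃ v ∈ N, e' = s(v, d)) then (0 : unitInterval) else K e' with hK'
    have hK'le : ∀ e : Sym2 (Fin n), (K' e : ℝ) = 0 ∨ K' e = K e := by
      intro e
      by_cases h : ∃ v ∈ N, e = s(v, d)
      · left
        simp only [hK', h, if_true]
        rfl
      · right
        simp only [hK', h, if_false]
    have h0 : ∀ v ∈ N, K' s(v, d) = 0 := by
      intro v hv
      have : ∃ v' ∈ N, s(v, d) = s(v', d) := ⟨v, hv, rfl⟩
      simp only [hK', this, if_true]
    have hzero : ∀ e : Sym2 (Fin n), (K e : ℝ) = 0 → K' e = 0 := by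
      intro e he
      rcases hK'le e with h | h
      · exact Set.Icc.coe_eq_zero.1 h
      · rw [h]
        exact Set.Icc.coe_eq_zero.1 he
    have hfree' : ∀ v ∈ N, ∀ y : Fin n, y ∉ A → y ∉ N → (K' s(v, y) : ℝ) = 0 :=
      fun v hv y hyA hyN => Set.Icc.coe_eq_zero.2 (hzero _ (hfree v hv y hyA hyN))
    have hle' : ∀ a ∈ A, (prodBernoulli K').real (openConn d b) ≤ (prodBernoulli K').real (openConn a b) :=
      fun a ha => fingerML3_hyp_dPairsKilled K N d a b hdN hlt (hle a ha)
    have hint' : ∀ v ∈ N, ∀ v' ∈ N, v ≠ v' → K' s(v, v') = 0 := fun v hv v' hv' hne => hzero _ (hint v hv v' hv' hne)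
    exact fingerML3_of_dPairsKilled K A N d b hd hdN
      (fingerML3_fourRelays_dUntouchedB K' A N w₁ w₂ d b hNA hd hb hw₁A hw₂A hAform h12 h1b h2b hfree' hle' h0 hint')

end FingerFourRelaysB

end

end Summit.CriticalPhenomena.PercolationContinuityZ3.Theorems
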